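import Summits.AtomisticToContinuum.HydrodynamicLimit.Theses.OneFlightGossipEngine
import Summits.AtomisticToContinuum.HydrodynamicLimit.Theorems.OneFlightGossipEngineKineticCurrentsWindowLDUniformStaticHydroDominationPrelim
import Literature.MathematicalPhysics.KineticTheory.HardSphereEulerProofs
import Literature.MathematicalPhysics.KineticTheory.VelocityBlindPlacement
import HarnessLib

/-!
# Static hydrodynamic domination, uniform on `𝕋³`
# (registered stub `stub_staticHydroDomination` of line `local-gibbs-entropy-ledger`,
# crux `KineticCurrentsWindowLDUniform`, stmt-AtomisticToContinuum-14662)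

**Result (S1).** For continuous profiles `θ₀ > 0`, `u₀` on `𝕋³` and a continuous observable `F` on
`𝕋³ × ℝ³` with `|F(x,v)| ≤ C(1 + ‖v‖²)`, orthogonal at every `x` to `1, vⱼ, ‖v‖²` under the local
Maxwellian `M_x = M_{1,θ₀(x),u₀(x)}`, there is `K ≥ 0` with
`|∫ F(x,v) M_{1,θ,u}(v) dv| ≤ K · E_x(u,θ)`, `E_x(u,θ) = ‖u-u₀(x)‖²/(2θ₀(x)) + (3/2) h(θ/θ₀(x))`,
`h(s) = s - 1 - log s`, for all `x ∈ 𝕋³`, `u ∈ ℝ³`, `θ > 0`.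

**Proof.** *Reduction.* With `G_x(w) = F(x, u₀(x) + √θ₀(x) w)` the transfer identity
`∫ g M_{1,θ,u} dv = ∫ g(u + √θ w) dγ(w)` gives `∫ F(x,·) M_{1,θ,u} = ∫ G_x M_{1,s,ũ}` with
`s = θ/θ₀(x)`, `ũ = (u - u₀(x))/√θ₀(x)` (`shd_shift_eq`), `E_x(u,θ) = ‖ũ‖²/2 + (3/2)h(s)`, the three
orthogonality relations become `G_x ⊥ 1, wⱼ, ‖w‖²` under the standard Gaussian `γ`
(`shd_orth_transfer`), and `|G_x(w)| ≤ C(1 + 2U² + 2Θ)(1+‖w‖²)` with `U = max ‖u₀‖`, `Θ = max θ₀`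
(compactness of `𝕋³`). *Normalised estimate* (`shd_normalized`, universal `K₀`). Far from `(1,0)`
(`‖ũ‖ > 1` or `|s-1| > 1/4`) the entropy is `≥ 1/64` while the crude bound
`|∫ G M_{1,s,ũ}| ≤ C(1+2‖ũ‖²+2s)J₁ ≤ C(5 + 4E)J₁` is affine in `E`. Near `(1,0)` write
`M_{1,s,ũ} = M_{1,1,0} e^q` with `q ∈ span{1, wⱼ, ‖w‖²}`; orthogonality kills the zeroth and first
order, `∫ G M_{1,s,ũ} = ∫ G M_{1,1,0}(e^q - 1 - q)`, and `|e^q - 1 - q| ≤ q²(1 + e^q)`,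
`q² ≤ 100(‖ũ‖² + (s-1)²)(1+‖w‖²)²`, sixth Gaussian moments (Fernique) and
`‖ũ‖² + (s-1)² ≤ 4E` (`h(s) ≥ (s-1)²/6`) give `|∫ G M_{1,s,ũ}| ≤ 97200 J₃ C E`.
The preliminaries (real inequalities, Gaussian tools, tilt identity) are in `…StaticHydroDominationPrelim`.
-/

noncomputable section

open MeasureTheory Set Filter InformationTheory ProbabilityTheory
open scoped ENNReal Topology

namespace Summit.AtomisticToContinuum.HydrodynamicLimit.Theorems.KineticCurrentsWindowLDUniformLocalGibbs

open Literature.Analysis.FluidPDE (HardSphereFlow Config localMaxwellian canonicalDensity liouville)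
open Literature.MathematicalPhysics.KineticTheory (T3 V3 hsDiameter localGibbsLaw localGibbsMeasure
  localGibbsProfile gaussMeasure localMaxwellian_nonneg exists_forall_abs_le_of_continuous)
open Summit.AtomisticToContinuum.HydrodynamicLimit.Theses.OneFlightGossipEngine
  (KineticCurrentsWindowLDUniform)
open Literature.MathematicalPhysics.KineticTheory.VelocityBlindPlacement (Flow)
open Summit.AtomisticToContinuum.HydrodynamicLimit.Theorems.KineticCurrentsWindowTilt
  (one_add_norm_shift_sq_le)

/-! ### The normalised estimate at the reference state `(θ₀, u₀) = (1, 0)` -/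

/-- Cubic moments of the two Maxwellians of the near region: `∫ (1+‖w‖²)³ (M_{1,1,0} + M_{1,s,ũ})
≤ 243 ∫ (1+‖w‖²)³ dγ` for `‖ũ‖ ≤ 1`, `|s - 1| ≤ 1/4`. [folklore] -/
theorem shd_cubic_moments_le {ũ : V3} (hu : ‖ũ‖ ≤ 1) {s : ℝ} (hs1 : |s - 1| ≤ 1 / 4) :
    (∫ w, (1 + ‖w‖ ^ 2) ^ 3 * localMaxwellian 1 1 (0 : V3) w) +
        ∫ w, (1 + ‖w‖ ^ 2) ^ 3 * localMaxwellian 1 s ũ w ≤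
      243 * ∫ w, (1 + ‖w‖ ^ 2) ^ 3 ∂stdGaussian V3 := by
  have hs : 0 < s := by linarith [(abs_le.1 hs1).1]
  have hJ : 0 ≤ ∫ w, (1 + ‖w‖ ^ 2) ^ 3 ∂stdGaussian V3 := integral_nonneg fun w => by positivity
  have h27 : ∫ w, (1 + ‖w‖ ^ 2) ^ 3 * localMaxwellian 1 1 (0 : V3) w ≤
      27 * ∫ w, (1 + ‖w‖ ^ 2) ^ 3 ∂stdGaussian V3 := by
    have h := shd_integral_moment_le 3 (0 : V3) one_pos
    have h0 : (1 + 2 * ‖(0 : V3)‖ ^ 2 + 2 * (1 : ℝ)) ^ 3 = 27 := by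
      rw [norm_zero]
      norm_num
    rwa [h0] at h
  have h216 : ∫ w, (1 + ‖w‖ ^ 2) ^ 3 * localMaxwellian 1 s ũ w ≤
      216 * ∫ w, (1 + ‖w‖ ^ 2) ^ 3 ∂stdGaussian V3 := by
    have h := shd_integral_moment_le 3 ũ hs
    have hb : (1 + 2 * ‖ũ‖ ^ 2 + 2 * s) ^ 3 ≤ 216 := by
      have h6 : 1 + 2 * ‖ũ‖ ^ 2 + 2 * s ≤ 6 := by
        nlinarith [(abs_le.1 hs1).2, norm_nonneg ũ]
      calc (1 + 2 * ‖ũ‖ ^ 2 + 2 * s) ^ 3 ≤ (6 : ℝ) ^ 3 := pow_le_pow_left₀ (by positivity) h6 3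
        _ = 216 := by norm_num
    exact h.trans (mul_le_mul_of_nonneg_right hb hJ)
  linarith

/-- **Near bound**: for `‖ũ‖ ≤ 1`, `|s - 1| ≤ 1/4` and `G ⊥ 1, wⱼ, ‖w‖²` under `γ`,
`|∫ G M_{1,s,ũ}| ≤ C · 100 (‖ũ‖² + (s-1)²) · 243 ∫ (1+‖w‖²)³ dγ`. [folklore] -/
theorem shd_near_bound {G : V3 → ℝ} (hG : Continuous G) {C : ℝ}
    (hGb : ∀ w, |G w| ≤ C * (1 + ‖w‖ ^ 2)) (H0 : ∫ w, G w ∂stdGaussian V3 = 0)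
    (H1 : ∀ j : Fin 3, ∫ w, G w * w j ∂stdGaussian V3 = 0)
    (H2 : ∫ w, G w * ‖w‖ ^ 2 ∂stdGaussian V3 = 0) {ũ : V3} (hu : ‖ũ‖ ≤ 1) {s : ℝ}
    (hs1 : |s - 1| ≤ 1 / 4) :
    |∫ w, G w * localMaxwellian 1 s ũ w| ≤
      C * (100 * (‖ũ‖ ^ 2 + (s - 1) ^ 2)) * (243 * ∫ w, (1 + ‖w‖ ^ 2) ^ 3 ∂stdGaussian V3) := by
  have hs : 0 < s := by linarith [(abs_le.1 hs1).1]
  have hC : 0 ≤ C := shd_const_nonneg hGb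
  obtain ⟨hI0, hI1, hI2⟩ := shd_integrable_moments hG hGb
  set ρ2 := ‖ũ‖ ^ 2 + (s - 1) ^ 2 with hρ2
  have hρ : 0 ≤ ρ2 := by positivity
  obtain ⟨q, hq⟩ : ∃ q : V3 → ℝ,
      ∀ w, q w = -(3 / 2) * Real.log s - ‖w - ũ‖ ^ 2 / (2 * s) + ‖w‖ ^ 2 / 2 := ⟨_, fun w => rfl⟩
  have hqc : Continuous q := shd_continuous_tilt hq
  have hqb : ∀ w, q w ^ 2 ≤ 100 * ρ2 * (1 + ‖w‖ ^ 2) ^ 2 := fun w => shd_tilt_sq_le hs1 hu w hq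
  -- the two vanishing Lebesgue integrals
  have hGM0 : ∫ w, G w * localMaxwellian 1 1 (0 : V3) w = 0 := by
    rw [shd_integral_mul_localMaxwellian G 0 one_pos]
    simpa using H0
  have hGqM0 : ∫ w, G w * q w * localMaxwellian 1 1 (0 : V3) w = 0 := by
    rw [shd_integral_mul_localMaxwellian (fun w => G w * q w) 0 one_pos]
    simp only [Real.sqrt_one, one_smul, zero_add]
    simp_rw [shd_tilt_eq_affine hs ũ _ hq]
    rw [shd_integral_affine_comb hI0 hI1 hI2, H0, H2]
    simp [H1]
  -- Lebesgue integrability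
  have hL1 : Integrable (fun w => G w * localMaxwellian 1 s ũ w) :=
    shd_integrable_mul_localMaxwellian hG (C := C) (m := 1) (by simpa using hGb) ũ hs
  have hL2 : Integrable (fun w => G w * localMaxwellian 1 1 (0 : V3) w) :=
    shd_integrable_mul_localMaxwellian hG (C := C) (m := 1) (by simpa using hGb) 0 one_pos
  have hL3 : Integrable (fun w => G w * q w * localMaxwellian 1 1 (0 : V3) w) := by
    refine shd_integrable_mul_localMaxwellian (g := fun w => G w * q w) (hG.mul hqc)
      (C := C * (1 + 100 * ρ2)) (m := 3) (fun w => ?_) 0 one_pos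
    rw [abs_mul]
    calc |G w| * |q w|
        ≤ C * (1 + ‖w‖ ^ 2) * ((1 + 100 * ρ2) * (1 + ‖w‖ ^ 2) ^ 2) :=
          mul_le_mul (hGb w) (shd_abs_tilt_le hs1 hu w hq) (abs_nonneg _) (by positivity)
      _ = C * (1 + 100 * ρ2) * (1 + ‖w‖ ^ 2) ^ 3 := by ring
  have hI3 : ∀ (u' : V3) {s' : ℝ}, 0 < s' →
      Integrable (fun w => (1 + ‖w‖ ^ 2) ^ 3 * localMaxwellian 1 s' u' w) := fun u' s' hs' =>
    shd_integrable_mul_localMaxwellian (g := fun w => (1 + ‖w‖ ^ 2) ^ 3) (by fun_prop) (C := 1)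
      (m := 3) (fun w => by rw [one_mul, abs_of_nonneg (by positivity)]) u' hs'
  -- the second-order identity
  have hΦ : ∫ w, G w * localMaxwellian 1 s ũ w =
      ∫ w, (G w * localMaxwellian 1 s ũ w - G w * localMaxwellian 1 1 (0 : V3) w -
        G w * q w * localMaxwellian 1 1 (0 : V3) w) := by
    rw [integral_sub _ hL3, integral_sub hL1 hL2, hGM0, hGqM0]
    · ring
    · exact hL1.sub hL2
  -- pointwise bound
  have hpt : ∀ w, ‖G w * localMaxwellian 1 s ũ w - G w * localMaxwellian 1 1 (0 : V3) w -
      G w * q w * localMaxwellian 1 1 (0 : V3) w‖ ≤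
      C * (100 * ρ2) * ((1 + ‖w‖ ^ 2) ^ 3 * localMaxwellian 1 1 (0 : V3) w +
        (1 + ‖w‖ ^ 2) ^ 3 * localMaxwellian 1 s ũ w) := by
    intro w
    have hT1 := shd_localMaxwellian_eq_mul_exp hs ũ w hq
    have hM0 : 0 ≤ localMaxwellian 1 1 (0 : V3) w := localMaxwellian_nonneg zero_le_one zero_le_one 0 w
    have hMw : 0 ≤ localMaxwellian 1 s ũ w := localMaxwellian_nonneg zero_le_one hs.le ũ w
    have hexp := shd_abs_exp_sub_one_sub_le (q w)
    have he : G w * localMaxwellian 1 s ũ w - G w * localMaxwellian 1 1 (0 : V3) w -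
        G w * q w * localMaxwellian 1 1 (0 : V3) w =
        G w * localMaxwellian 1 1 (0 : V3) w *
          (Real.exp (q w) - 1 - q w) := by
      rw [hT1]; ring
    rw [Real.norm_eq_abs, he, abs_mul, abs_mul, abs_of_nonneg hM0]
    calc |G w| * localMaxwellian 1 1 (0 : V3) w * |Real.exp (q w) - 1 - q w|
        ≤ C * (1 + ‖w‖ ^ 2) * localMaxwellian 1 1 (0 : V3) w *
            (q w ^ 2 * (1 + Real.exp (q w))) := by
          gcongr
          exact hGb w
      _ = C * (1 + ‖w‖ ^ 2) * q w ^ 2 *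
            (localMaxwellian 1 1 (0 : V3) w + localMaxwellian 1 s ũ w) := by
          rw [hT1]; ring
      _ ≤ C * (1 + ‖w‖ ^ 2) * (100 * ρ2 * (1 + ‖w‖ ^ 2) ^ 2) *
            (localMaxwellian 1 1 (0 : V3) w + localMaxwellian 1 s ũ w) := by
          gcongr
          exact hqb w
      _ = C * (100 * ρ2) * ((1 + ‖w‖ ^ 2) ^ 3 * localMaxwellian 1 1 (0 : V3) w +
            (1 + ‖w‖ ^ 2) ^ 3 * localMaxwellian 1 s ũ w) := by ring
  have hB : Integrable (fun w => C * (100 * ρ2) *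
      ((1 + ‖w‖ ^ 2) ^ 3 * localMaxwellian 1 1 (0 : V3) w +
        (1 + ‖w‖ ^ 2) ^ 3 * localMaxwellian 1 s ũ w)) :=
    ((hI3 0 one_pos).add (hI3 ũ hs)).const_mul _
  rw [hΦ]
  refine (norm_integral_le_of_norm_le hB (Eventually.of_forall hpt)).trans ?_
  rw [integral_const_mul, integral_add (hI3 0 one_pos) (hI3 ũ hs)]
  exact mul_le_mul_of_nonneg_left (shd_cubic_moments_le hu hs1) (by positivity)

/-- **Normalised static domination.** There is a universal `K₀ ≥ 0` such that for every continuous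
`G` on `ℝ³` with `|G| ≤ C(1+‖w‖²)` and `G ⊥ 1, wⱼ, ‖w‖²` under the standard Gaussian `γ`,
`|∫ G M_{1,s,ũ}| ≤ K₀ C (‖ũ‖²/2 + (3/2)(s - 1 - log s))` for all `ũ ∈ ℝ³`, `s > 0`. [folklore] -/
theorem shd_normalized :
    ∃ K₀ : ℝ, 0 ≤ K₀ ∧ ∀ (G : V3 → ℝ) (C : ℝ), Continuous G →
      (∀ w, |G w| ≤ C * (1 + ‖w‖ ^ 2)) →
      (∫ w, G w ∂stdGaussian V3 = 0) → (∀ j : Fin 3, ∫ w, G w * w j ∂stdGaussian V3 = 0) →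
      (∫ w, G w * ‖w‖ ^ 2 ∂stdGaussian V3 = 0) →
      ∀ (ũ : V3) (s : ℝ), 0 < s →
        |∫ w, G w * localMaxwellian 1 s ũ w| ≤
          K₀ * C * (‖ũ‖ ^ 2 / 2 + 3 / 2 * (s - 1 - Real.log s)) := by
  set J₁ := ∫ w, (1 + ‖w‖ ^ 2) ∂stdGaussian V3 with hJ₁def
  set J₃ := ∫ w, (1 + ‖w‖ ^ 2) ^ 3 ∂stdGaussian V3 with hJ₃def
  have hJ₁ : 0 ≤ J₁ := integral_nonneg fun w => by positivity
  have hJ₃ : 0 ≤ J₃ := integral_nonneg fun w => by positivity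
  refine ⟨324 * J₁ + 97200 * J₃, by positivity, ?_⟩
  intro G C hG hGb H0 H1 H2 ũ s hs
  have hC : 0 ≤ C := shd_const_nonneg hGb
  have hh : 0 ≤ s - 1 - Real.log s := by linarith [Real.log_le_sub_one_of_pos hs]
  have hE0 : 0 ≤ ‖ũ‖ ^ 2 / 2 + 3 / 2 * (s - 1 - Real.log s) := by positivity
  by_cases hnear : ‖ũ‖ ≤ 1 ∧ |s - 1| ≤ 1 / 4
  · -- near region
    have hnb := shd_near_bound hG hGb H0 H1 H2 hnear.1 hnear.2
    have hElow : ‖ũ‖ ^ 2 + (s - 1) ^ 2 ≤ 4 * (‖ũ‖ ^ 2 / 2 + 3 / 2 * (s - 1 - Real.log s)) := by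
      have := shd_h_near hnear.2
      nlinarith [sq_nonneg ‖ũ‖]
    calc |∫ w, G w * localMaxwellian 1 s ũ w|
        ≤ C * (100 * (‖ũ‖ ^ 2 + (s - 1) ^ 2)) * (243 * J₃) := hnb
      _ ≤ C * (100 * (4 * (‖ũ‖ ^ 2 / 2 + 3 / 2 * (s - 1 - Real.log s)))) * (243 * J₃) := by
          gcongr
      _ = 97200 * J₃ * C * (‖ũ‖ ^ 2 / 2 + 3 / 2 * (s - 1 - Real.log s)) := by ring
      _ ≤ (324 * J₁ + 97200 * J₃) * C * (‖ũ‖ ^ 2 / 2 + 3 / 2 * (s - 1 - Real.log s)) := by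
          have : 0 ≤ 324 * J₁ * C * (‖ũ‖ ^ 2 / 2 + 3 / 2 * (s - 1 - Real.log s)) := by
            positivity
          nlinarith
  · -- far region
    have hEfar : 1 / 64 ≤ ‖ũ‖ ^ 2 / 2 + 3 / 2 * (s - 1 - Real.log s) := by
      rcases not_and_or.1 hnear with h | h
      · have h' : 1 < ‖ũ‖ := not_le.1 h
        have : 1 < ‖ũ‖ ^ 2 := by nlinarith
        nlinarith
      · have := shd_h_far hs (not_le.1 h).le
        nlinarith [sq_nonneg ‖ũ‖]
    have hgrowth : 1 + 2 * ‖ũ‖ ^ 2 + 2 * s ≤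
        5 + 4 * (‖ũ‖ ^ 2 / 2 + 3 / 2 * (s - 1 - Real.log s)) := by
      have := shd_le_two_mul_h hs
      nlinarith
    calc |∫ w, G w * localMaxwellian 1 s ũ w|
        ≤ C * ((1 + 2 * ‖ũ‖ ^ 2 + 2 * s) * J₁) := shd_global_bound hGb ũ hs
      _ ≤ C * ((5 + 4 * (‖ũ‖ ^ 2 / 2 + 3 / 2 * (s - 1 - Real.log s))) * J₁) := by gcongr
      _ ≤ C * ((320 * (‖ũ‖ ^ 2 / 2 + 3 / 2 * (s - 1 - Real.log s)) +
            4 * (‖ũ‖ ^ 2 / 2 + 3 / 2 * (s - 1 - Real.log s))) * J₁) := by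
          gcongr
          linarith
      _ = 324 * J₁ * C * (‖ũ‖ ^ 2 / 2 + 3 / 2 * (s - 1 - Real.log s)) := by ring
      _ ≤ (324 * J₁ + 97200 * J₃) * C * (‖ũ‖ ^ 2 / 2 + 3 / 2 * (s - 1 - Real.log s)) := by
          have : 0 ≤ 97200 * J₃ * C * (‖ũ‖ ^ 2 / 2 + 3 / 2 * (s - 1 - Real.log s)) := by
            positivity
          nlinarith

/-! ### Reduction to the reference state and the stub -/

/-- **Orthogonality transfer.** If `Fx ⊥ 1, vⱼ, ‖v‖²` under `M_{1,θ₀,u₀} dv`, then the pulled-back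
observable `w ↦ Fx (u₀ + √θ₀ w)` is orthogonal to `1, wⱼ, ‖w‖²` under the standard Gaussian. [folklore] -/
theorem shd_orth_transfer {Fx : V3 → ℝ} (hF : Continuous Fx) {C : ℝ}
    (hC : ∀ v, |Fx v| ≤ C * (1 + ‖v‖ ^ 2)) (u₀ : V3) {θ₀ : ℝ} (hθ₀ : 0 < θ₀)
    (H0 : ∫ v, Fx v * localMaxwellian 1 θ₀ u₀ v = 0)
    (H1 : ∀ j : Fin 3, ∫ v, Fx v * v j * localMaxwellian 1 θ₀ u₀ v = 0)
    (H2 : ∫ v, Fx v * ‖v‖ ^ 2 * localMaxwellian 1 θ₀ u₀ v = 0) :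
    (∫ w, Fx (u₀ + Real.sqrt θ₀ • w) ∂stdGaussian V3 = 0) ∧
    (∀ j : Fin 3, ∫ w, Fx (u₀ + Real.sqrt θ₀ • w) * w j ∂stdGaussian V3 = 0) ∧
    (∫ w, Fx (u₀ + Real.sqrt θ₀ • w) * ‖w‖ ^ 2 ∂stdGaussian V3 = 0) := by
  have hC0 : 0 ≤ C := shd_const_nonneg hC
  have hGc : Continuous fun w : V3 => Fx (u₀ + Real.sqrt θ₀ • w) := hF.comp (by fun_prop)
  have hGb : ∀ w : V3, |Fx (u₀ + Real.sqrt θ₀ • w)| ≤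
      C * (1 + 2 * ‖u₀‖ ^ 2 + 2 * θ₀) * (1 + ‖w‖ ^ 2) := fun w => by
    rw [mul_assoc]
    exact (hC _).trans (mul_le_mul_of_nonneg_left (one_add_norm_shift_sq_le u₀ w hθ₀) hC0)
  obtain ⟨hI0, hI1, hI2⟩ := shd_integrable_moments hGc hGb
  have hsq : 0 < Real.sqrt θ₀ := Real.sqrt_pos.2 hθ₀
  -- zeroth moment
  have h0 : ∫ w, Fx (u₀ + Real.sqrt θ₀ • w) ∂stdGaussian V3 = 0 := by
    rw [← shd_integral_mul_localMaxwellian Fx u₀ hθ₀]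
    exact H0
  -- first moments
  have h1 : ∀ j : Fin 3, ∫ w, Fx (u₀ + Real.sqrt θ₀ • w) * w j ∂stdGaussian V3 = 0 := by
    intro j
    have h := H1 j
    rw [shd_integral_mul_localMaxwellian (fun v => Fx v * v j) u₀ hθ₀] at h
    simp only [PiLp.add_apply, PiLp.smul_apply, smul_eq_mul] at h
    have hf : (fun w : V3 => Fx (u₀ + Real.sqrt θ₀ • w) * (u₀ j + Real.sqrt θ₀ * w j)) =
        fun w => u₀ j * Fx (u₀ + Real.sqrt θ₀ • w) +
          Real.sqrt θ₀ * (Fx (u₀ + Real.sqrt θ₀ • w) * w j) := by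
      funext w
      ring
    rw [hf, integral_add (hI0.const_mul _) ((hI1 j).const_mul _), integral_const_mul,
      integral_const_mul, h0, mul_zero, zero_add] at h
    exact (mul_eq_zero.1 h).resolve_left hsq.ne'
  refine ⟨h0, h1, ?_⟩
  -- second moment
  have h := H2
  rw [shd_integral_mul_localMaxwellian (fun v => Fx v * ‖v‖ ^ 2) u₀ hθ₀] at h
  have hexp : ∀ w : V3, ‖u₀ + Real.sqrt θ₀ • w‖ ^ 2 =
      ‖u₀‖ ^ 2 + ∑ j, (2 * Real.sqrt θ₀ * u₀ j) * w j + Real.sqrt θ₀ ^ 2 * ‖w‖ ^ 2 := by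
    intro w
    simp only [EuclideanSpace.real_norm_sq_eq, PiLp.add_apply, PiLp.smul_apply, smul_eq_mul,
      Fin.sum_univ_three]
    ring
  simp only [hexp] at h
  rw [shd_integral_affine_comb hI0 hI1 hI2, h0] at h
  simp only [h1, mul_zero, Finset.sum_const_zero, add_zero, zero_add] at h
  exact (mul_eq_zero.1 h).resolve_left (pow_ne_zero 2 hsq.ne')

/-- The affine change of variables behind the reduction:
`u₀ + √θ₀ ((√θ₀)⁻¹ (u - u₀) + √(θ/θ₀) w) = u + √θ w`. [folklore] -/
theorem shd_shift_eq (u u₀ w : V3) {θ₀ : ℝ} (hθ₀ : 0 < θ₀) (θ : ℝ) :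
    u₀ + Real.sqrt θ₀ • ((Real.sqrt θ₀)⁻¹ • (u - u₀) + Real.sqrt (θ / θ₀) • w) =
      u + Real.sqrt θ • w := by
  have hsq : 0 < Real.sqrt θ₀ := Real.sqrt_pos.2 hθ₀
  rw [smul_add, smul_smul, smul_smul, mul_inv_cancel₀ hsq.ne', one_smul,
    ← Real.sqrt_mul hθ₀.le, mul_div_cancel₀ _ hθ₀.ne']
  abel

/-- S1 — STATIC HYDRODYNAMIC DOMINATION, UNIFORM ON `𝕋³` (card: `StaticHydroDomination`; static, M).
For continuous `θ₀ > 0`, `u₀` on `𝕋³` and a continuous `F` on `𝕋³ × ℝ³` of quadratic growth, orthogonal at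
every `x` to `1, v_j, ‖v‖²` under `M_x = M_{1,u₀(x),θ₀(x)}`, the Maxwellian average
`Φ_F(x;u,θ) = ∫ F(x,v) M_{1,u,θ}(v) dv` is dominated, uniformly in `x`, by the Gaussian relative entropy
`E_x(u,θ) = KL(N(u,θI) ‖ N(u₀(x),θ₀(x)I)) = ‖u-u₀(x)‖²/(2θ₀(x)) + (3/2)(θ/θ₀(x) - 1 - log(θ/θ₀(x)))`.
(`Φ_F(x;·)` is smooth in `(u, θ > 0)`, vanishes to second order at `(u₀(x),θ₀(x))` exactly by the three
clauses, is `O(1 + ‖u‖² + θ)`; `E_x` is uniformly convex at its zero, `→ ∞` as `θ → 0`; compactness of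
`𝕋³` and joint continuity make `K` uniform. Sharp on Disproof §3's witnesses: `K = 2θ₀λ_max(A_sym)` for
`F = A:(w ⊗ w)`.) -/
theorem stub_staticHydroDomination :
    ∀ (θ₀ : T3 → ℝ) (u₀ : T3 → V3), Continuous θ₀ → Continuous u₀ → (∀ x, 0 < θ₀ x) →
      ∀ (F : T3 × V3 → ℝ), Continuous F → ∀ C : ℝ, (∀ y, |F y| ≤ C * (1 + ‖y.2‖ ^ 2)) →
      (∀ x, ∫ v, F (x, v) * localMaxwellian 1 (θ₀ x) (u₀ x) v = 0) →
      (∀ x (j : Fin 3), ∫ v, F (x, v) * v j * localMaxwellian 1 (θ₀ x) (u₀ x) v = 0) →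
      (∀ x, ∫ v, F (x, v) * ‖v‖ ^ 2 * localMaxwellian 1 (θ₀ x) (u₀ x) v = 0) →
      ∃ K : ℝ, 0 ≤ K ∧ ∀ (x : T3) (u : V3) (θ : ℝ), 0 < θ →
        |∫ v, F (x, v) * localMaxwellian 1 θ u v| ≤
          K * (‖u - u₀ x‖ ^ 2 / (2 * θ₀ x) + 3 / 2 * (θ / θ₀ x - 1 - Real.log (θ / θ₀ x))) := by
  intro θ₀ u₀ hθc huc hpos F hF C hC H0 H1 H2
  obtain ⟨K₀, hK₀, hnorm⟩ := shd_normalized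
  obtain ⟨U, hU0, hU⟩ := exists_forall_abs_le_of_continuous (χ := fun x => ‖u₀ x‖) (by fun_prop)
  obtain ⟨Θ, hΘ0, hΘ⟩ := exists_forall_abs_le_of_continuous hθc
  have hC0 : 0 ≤ C := shd_const_nonneg (G := fun v => F ((0 : T3), v)) fun v => hC ((0 : T3), v)
  refine ⟨K₀ * (C * (1 + 2 * U ^ 2 + 2 * Θ)), by positivity, fun x u θ hθ => ?_⟩
  have hθ₀ : 0 < θ₀ x := hpos x
  have hsq : 0 < Real.sqrt (θ₀ x) := Real.sqrt_pos.2 hθ₀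
  -- the pulled-back observable at `x` and its growth
  have hGc : Continuous fun w : V3 => F (x, u₀ x + Real.sqrt (θ₀ x) • w) := by fun_prop
  have hGb : ∀ w : V3, |F (x, u₀ x + Real.sqrt (θ₀ x) • w)| ≤
      C * (1 + 2 * U ^ 2 + 2 * Θ) * (1 + ‖w‖ ^ 2) := by
    intro w
    have h1 : |F (x, u₀ x + Real.sqrt (θ₀ x) • w)| ≤
        C * (1 + ‖u₀ x + Real.sqrt (θ₀ x) • w‖ ^ 2) := hC (x, _)
    have h2 := one_add_norm_shift_sq_le (u₀ x) w hθ₀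
    have hu : ‖u₀ x‖ ≤ U := (abs_le.1 (hU x)).2
    have ht : θ₀ x ≤ Θ := (abs_le.1 (hΘ x)).2
    have h3 : 1 + 2 * ‖u₀ x‖ ^ 2 + 2 * θ₀ x ≤ 1 + 2 * U ^ 2 + 2 * Θ := by
      nlinarith [norm_nonneg (u₀ x)]
    calc |F (x, u₀ x + Real.sqrt (θ₀ x) • w)|
        ≤ C * (1 + ‖u₀ x + Real.sqrt (θ₀ x) • w‖ ^ 2) := h1
      _ ≤ C * ((1 + 2 * ‖u₀ x‖ ^ 2 + 2 * θ₀ x) * (1 + ‖w‖ ^ 2)) := by gcongr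
      _ ≤ C * ((1 + 2 * U ^ 2 + 2 * Θ) * (1 + ‖w‖ ^ 2)) := by gcongr
      _ = C * (1 + 2 * U ^ 2 + 2 * Θ) * (1 + ‖w‖ ^ 2) := by ring
  obtain ⟨h0, h1, h2⟩ := shd_orth_transfer (Fx := fun v => F (x, v)) (by fun_prop)
    (fun v => hC (x, v)) (u₀ x) hθ₀ (H0 x) (H1 x) (H2 x)
  have key := hnorm _ _ hGc hGb h0 h1 h2 ((Real.sqrt (θ₀ x))⁻¹ • (u - u₀ x)) (θ / θ₀ x)
    (div_pos hθ hθ₀)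
  -- identify the Maxwellian average
  have hint : ∫ v, F (x, v) * localMaxwellian 1 θ u v =
      ∫ w, F (x, u₀ x + Real.sqrt (θ₀ x) • w) *
        localMaxwellian 1 (θ / θ₀ x) ((Real.sqrt (θ₀ x))⁻¹ • (u - u₀ x)) w := by
    rw [shd_integral_mul_localMaxwellian (fun v => F (x, v)) u hθ,
      shd_integral_mul_localMaxwellian _ _ (div_pos hθ hθ₀)]
    refine integral_congr_ae (Eventually.of_forall fun w => ?_)
    simp only [shd_shift_eq u (u₀ x) w hθ₀ θ]
  -- identify the entropy
  have hnormsq : ‖(Real.sqrt (θ₀ x))⁻¹ • (u - u₀ x)‖ ^ 2 / 2 = ‖u - u₀ x‖ ^ 2 / (2 * θ₀ x) := by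
    rw [norm_smul, norm_inv, Real.norm_eq_abs, abs_of_pos hsq, mul_pow, inv_pow,
      Real.sq_sqrt hθ₀.le]
    field_simp
  rw [hint]
  rw [hnormsq] at key
  exact key

end Summit.AtomisticToContinuum.HydrodynamicLimit.Theorems.KineticCurrentsWindowLDUniformLocalGibbs

end
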